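import Summits.AnomalousDissipation.AnomalousDissipation.Theorems.SawtoothPulseCascadeK1LocalisedCascadeLedger

/-!
# K1loc, line `Spectral` / SeqCone — helper: THE LEDGER WITH THE SHARP BUDGET `√(q₀² + Z) + E < ‖θ₀‖`

Helper file of the prover lane on the crux `K1LocalisedCascade` (stmt-AnomalousDissipation-19491), route
`SawtoothPulseCascade` (companion of `…K1LocalisedCascadeLedger`).  `…K1Ledger.chain_le` sums the energy-form recursion
`a_{s+1}² ≤ (a_s + ε_s)² + ζ_s` as `a_n ≤ a_m + Σε + √Σζ`, which charges the START value `a_m` as an amplitude against the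
zone energies.  The same one-line inequality `(x + e)² + ζ ≤ (√(x² + ζ) + e)²` gives the sharper
  `a_n ≤ √(a_m² + Σ_{s<n} ζ_s) + Σ_{s<n} ε_s`                                                    (`chain_le_sharp`),
i.e. the start ENERGY and the zone ENERGIES add under one root and only the commutator amplitudes add linearly — the form
in which the first-good-piece budget of the line is stated (memo v7: `q₀² + Z` against `‖θ₀‖²`).  Consequences:
`phase_chain_le_sharp` (H/V indexing) and **`highModeConcentration_of_ledger_sharp`**: the ledger theorem
`…K1Ledger.highModeConcentration_of_ledger` with the budget hypothesis replaced by `√(q₀² + Z) + E < ‖θ₀‖_{L²}`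
(`χ = (1 − (√(q₀²+Z)+E)²/‖θ₀‖²)/2`); `highModeConcentration_of_ledger_threshold` — the same with the lag requirements asked
only for `0 < κ ≤ κ₁` (`A = 0` allowed); `tsum_symbol_sq_le_energy_off` — the start socket (a symbol `≤ 1` vanishing on a
set of modes is dominated by the energy off that set).  No definitions; no statement about the stub.
[cite: DEIJ2022, (1.2)–(1.3) (κ-uniform dissipated fraction)] [cite: Grafakos2014, Prop. 3.2.7 (3) (Parseval)] [problem: turb]
-/

-- `Summit.<Summit>.<Problem>`: single-conjunct summit, the duplicate namespace segment is deliberate.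
set_option linter.dupNamespace false

noncomputable section

namespace Summit.AnomalousDissipation.AnomalousDissipation.Theorems.SawtoothPulseCascade.K1Ledger

open MeasureTheory Set Filter Topology UnitAddTorus Function
open scoped ENNReal
open Literature.Analysis Literature.Analysis.FunctionSpaces Literature.Analysis.FunctionSpaces.Torus
open Literature.Analysis.FluidPDE.Torus (highModeEnergy)
open Literature.Analysis.FluidPDE.SawtoothCascade Literature.Analysis.FluidPDE.SawtoothCascade.CascadeParams
open Summit.AnomalousDissipation.AnomalousDissipation.Theorems.SawtoothPulseCascade.SpectralLeakage
open Summit.AnomalousDissipation.AnomalousDissipation.Theorems.SawtoothPulseCascade.K1Slot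

/-! ## §1 The sharp one-step inequality and its sums -/

/-- **One ledger step, sharp form.**  If `0 ≤ x ≤ √S + E` and `y² ≤ (x + ε)² + ζ` with `y, S, E, ε, ζ ≥ 0`, then
`y ≤ √(S + ζ) + (E + ε)`: energies (`S`, `ζ`) add under the root, amplitudes (`E`, `ε`) add outside
(`(√S + E + ε)² + ζ ≤ (√(S+ζ) + E + ε)²`). [folklore] -/
theorem le_sqrt_add_add_of_sq_le {x y S E ε ζ : ℝ} (hx : 0 ≤ x) (hy : 0 ≤ y) (hS : 0 ≤ S) (hE : 0 ≤ E)
    (hε : 0 ≤ ε) (hζ : 0 ≤ ζ) (hxle : x ≤ Real.sqrt S + E) (hstep : y ^ 2 ≤ (x + ε) ^ 2 + ζ) :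
    y ≤ Real.sqrt (S + ζ) + (E + ε) := by
  have hsS : 0 ≤ Real.sqrt S := Real.sqrt_nonneg _
  have hsSζ : Real.sqrt S ≤ Real.sqrt (S + ζ) := Real.sqrt_le_sqrt (by linarith)
  have hB : 0 ≤ Real.sqrt (S + ζ) + (E + ε) := by positivity
  have h1 : (x + ε) ^ 2 ≤ (Real.sqrt S + E + ε) ^ 2 := pow_le_pow_left₀ (by positivity) (by linarith) 2
  have h2 : (Real.sqrt S + E + ε) ^ 2 + ζ ≤ (Real.sqrt (S + ζ) + (E + ε)) ^ 2 := by
    have hS2 : Real.sqrt S ^ 2 = S := Real.sq_sqrt hS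
    have hSζ2 : Real.sqrt (S + ζ) ^ 2 = S + ζ := Real.sq_sqrt (by linarith)
    nlinarith [hsSζ, hsS]
  have h3 : y ^ 2 ≤ (Real.sqrt (S + ζ) + (E + ε)) ^ 2 := by linarith
  exact (pow_le_pow_iff_left₀ hy hB (by norm_num : (2 : ℕ) ≠ 0)).1 h3

/-- **The ledger sums, sharp form** (half-slot indexing): for non-negative `a, ε, ζ` with `a_{s+1}² ≤ (a_s + ε_s)² + ζ_s`
for `m ≤ s < n`, `a_n ≤ √(a_m² + Σ_{s∈[m,n)} ζ_s) + Σ_{s∈[m,n)} ε_s`. [folklore] -/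
theorem chain_le_sharp {a ε ζ : ℕ → ℝ} (ha : ∀ s, 0 ≤ a s) (hε : ∀ s, 0 ≤ ε s) (hζ : ∀ s, 0 ≤ ζ s) (m : ℕ) :
    ∀ n, m ≤ n → (∀ s, m ≤ s → s < n → a (s + 1) ^ 2 ≤ (a s + ε s) ^ 2 + ζ s) →
      a n ≤ Real.sqrt (a m ^ 2 + ∑ s ∈ Finset.Ico m n, ζ s) + ∑ s ∈ Finset.Ico m n, ε s := by
  refine Nat.le_induction ?_ ?_
  · intro _
    simp [Real.sqrt_sq (ha m)]
  · intro n hmn ih hstep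
    have ih' := ih fun s hs hsn => hstep s hs (Nat.lt_succ_of_lt hsn)
    have hn := hstep n hmn (Nat.lt_succ_self n)
    rw [Finset.sum_Ico_succ_top hmn, Finset.sum_Ico_succ_top hmn, ← add_assoc]
    have h := le_sqrt_add_add_of_sq_le (ha n) (ha (n + 1)) (add_nonneg (sq_nonneg _) (Finset.sum_nonneg fun s _ => hζ s))
      (Finset.sum_nonneg fun s _ => hε s) (hε n) (hζ n) ih' hn
    simpa only [add_assoc] using h

/-- **The ledger sums, sharp form, phase indexing.**  Non-negative `Qᴴ, Qⱽ, εᴴ, εⱽ, ζᴴ, ζⱽ` with, for `i₀ ≤ j < J`,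
`(Qⱽ_j)² ≤ (Qᴴ_j + εᴴ_j)² + ζᴴ_j` and `(Qᴴ_{j+1})² ≤ (Qⱽ_j + εⱽ_j)² + ζⱽ_j` satisfy
`Qᴴ_J ≤ √((Qᴴ_{i₀})² + Σ_{j∈[i₀,J)} (ζᴴ_j + ζⱽ_j)) + Σ_{j∈[i₀,J)} (εᴴ_j + εⱽ_j)`. [folklore] -/
theorem phase_chain_le_sharp {QH QV εH εV ζH ζV : ℕ → ℝ} (hQH : ∀ j, 0 ≤ QH j) (hQV : ∀ j, 0 ≤ QV j)
    (hεH : ∀ j, 0 ≤ εH j) (hεV : ∀ j, 0 ≤ εV j) (hζH : ∀ j, 0 ≤ ζH j) (hζV : ∀ j, 0 ≤ ζV j) (i₀ : ℕ) :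
    ∀ J, i₀ ≤ J →
      (∀ j, i₀ ≤ j → j < J → QV j ^ 2 ≤ (QH j + εH j) ^ 2 + ζH j) →
      (∀ j, i₀ ≤ j → j < J → QH (j + 1) ^ 2 ≤ (QV j + εV j) ^ 2 + ζV j) →
        QH J ≤ Real.sqrt (QH i₀ ^ 2 + ∑ j ∈ Finset.Ico i₀ J, (ζH j + ζV j)) + ∑ j ∈ Finset.Ico i₀ J, (εH j + εV j) := by
  refine Nat.le_induction ?_ ?_
  · intro _ _
    simp [Real.sqrt_sq (hQH i₀)]
  · intro n hn ih hH hV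
    have ih' := ih (fun j hj hjn => hH j hj (Nat.lt_succ_of_lt hjn)) fun j hj hjn => hV j hj (Nat.lt_succ_of_lt hjn)
    have hHn := hH n hn (Nat.lt_succ_self n)
    have hVn := hV n hn (Nat.lt_succ_self n)
    set S : ℝ := QH i₀ ^ 2 + ∑ j ∈ Finset.Ico i₀ n, (ζH j + ζV j) with hS
    set E : ℝ := ∑ j ∈ Finset.Ico i₀ n, (εH j + εV j) with hE
    have hS0 : 0 ≤ S := add_nonneg (sq_nonneg _) (Finset.sum_nonneg fun j _ => add_nonneg (hζH j) (hζV j))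
    have hE0 : 0 ≤ E := Finset.sum_nonneg fun j _ => add_nonneg (hεH j) (hεV j)
    have h1 : QV n ≤ Real.sqrt (S + ζH n) + (E + εH n) :=
      le_sqrt_add_add_of_sq_le (hQH n) (hQV n) hS0 hE0 (hεH n) (hζH n) ih' hHn
    have h2 : QH (n + 1) ≤ Real.sqrt ((S + ζH n) + ζV n) + ((E + εH n) + εV n) :=
      le_sqrt_add_add_of_sq_le (hQV n) (hQH (n + 1)) (add_nonneg hS0 (hζH n)) (add_nonneg hE0 (hεH n))
        (hεV n) (hζV n) h1 hVn
    rw [Finset.sum_Ico_succ_top hn, Finset.sum_Ico_succ_top hn]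
    calc QH (n + 1) ≤ Real.sqrt ((S + ζH n) + ζV n) + ((E + εH n) + εV n) := h2
      _ = Real.sqrt (QH i₀ ^ 2 + (∑ j ∈ Finset.Ico i₀ n, (ζH j + ζV j) + (ζH n + ζV n))) +
            (∑ j ∈ Finset.Ico i₀ n, (εH j + εV j) + (εH n + εV n)) := by
          rw [hS, hE]; ring_nf

/-! ## §2 The stub's conclusion from a ledger, sharp budget -/

/-- **The tracked-symbol ledger gives the stub's conclusion — sharp budget.**  Same data and hypotheses as
`…K1Ledger.highModeConcentration_of_ledger` (symbol families `μᴴ, μⱽ`, `i₀ ≤ A`, low-block radius `cρ^J`, lag hypothesis,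
non-negative `εᴴ, εⱽ, ζᴴ, ζⱽ` with partial sums `≤ E`, `≤ Z`, start bound `q₀` (any sign: only `q₀²` enters), per-half-slot energy-form inequalities for
`0 < κ ≤ κ₁` and every classical cascade scalar from `θ₀`), except that the budget is the SHARP one,
`√(q₀² + Z) + E < ‖θ₀‖_{L²}`: the start energy `q₀²` and the zone energies `Z` add under one root.  Conclusion: the body
of `stub_highModeConcentration` for `(P, r, θ₀)` with `χ = (1 − (√(q₀²+Z)+E)²/‖θ₀‖²)/2`, lag `A`, `κ₀ = κ₁`, `K = cρ^J`.
[cite: DEIJ2022, (1.2)–(1.3)] [cite: Grafakos2014, Prop. 3.2.7 (3)] -/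
theorem highModeConcentration_of_ledger_sharp (P : CascadeParams) (r : ℝ) {θ₀ : UnitAddTorus (Fin 2) → ℝ}
    (hθ₀ : 0 < FluidPDE.Torus.scalarL2Sq θ₀)
    (μH μV : ℕ → (Fin 2 → ℤ) → ℝ) {M : ℝ} (hμH : ∀ j k, |μH j k| ≤ M)
    {i₀ A : ℕ} (hiA : i₀ ≤ A) {c ρ : ℝ} (hc : 0 < c) (hρ : 0 ≤ ρ)
    (hlow : ∀ J, i₀ ≤ J → ∀ k : Fin 2 → ℤ, |((k 0 : ℤ) : ℝ)| < c * ρ ^ J → 1 ≤ μH J k ^ 2)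
    (hlag : ∀ κ : ℝ, 0 < κ → 1 ≤ 8 * Real.pi ^ 2 * κ * (c * ρ ^ (Jrate r κ + A)) ^ 2 * tHalf (Jrate r κ + A))
    {εH εV ζH ζV : ℕ → ℝ} (hεH : ∀ j, 0 ≤ εH j) (hεV : ∀ j, 0 ≤ εV j) (hζH : ∀ j, 0 ≤ ζH j) (hζV : ∀ j, 0 ≤ ζV j)
    {E Z : ℝ} (hE : ∀ n, ∑ j ∈ Finset.Ico i₀ n, (εH j + εV j) ≤ E) (hZ : ∀ n, ∑ j ∈ Finset.Ico i₀ n, (ζH j + ζV j) ≤ Z)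
    {q₀ κ₁ : ℝ} (hκ₁ : 0 < κ₁)
    (hstart : ∀ κ ∈ Ioc (0 : ℝ) κ₁, ∀ w : ℝ → UnitAddTorus (Fin 2) → ℝ,
      FluidPDE.Torus.IsClassicalScalarTransportOn (Ico 0 1) κ P.field w → w 0 = θ₀ →
        Real.sqrt (∑' k, μH i₀ k ^ 2 * ‖mFourierCoeff (fun x => (w (tStart i₀) x : ℂ)) k‖ ^ 2) ≤ q₀)
    (hstepH : ∀ κ ∈ Ioc (0 : ℝ) κ₁, ∀ w : ℝ → UnitAddTorus (Fin 2) → ℝ,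
      FluidPDE.Torus.IsClassicalScalarTransportOn (Ico 0 1) κ P.field w → w 0 = θ₀ →
        ∀ j, i₀ ≤ j → j < Jrate r κ + A →
          ∑' k, μV j k ^ 2 * ‖mFourierCoeff (fun x => (w (tStart j + tHalf j) x : ℂ)) k‖ ^ 2 ≤
            (Real.sqrt (∑' k, μH j k ^ 2 * ‖mFourierCoeff (fun x => (w (tStart j) x : ℂ)) k‖ ^ 2) + εH j) ^ 2 + ζH j)
    (hstepV : ∀ κ ∈ Ioc (0 : ℝ) κ₁, ∀ w : ℝ → UnitAddTorus (Fin 2) → ℝ,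
      FluidPDE.Torus.IsClassicalScalarTransportOn (Ico 0 1) κ P.field w → w 0 = θ₀ →
        ∀ j, i₀ ≤ j → j < Jrate r κ + A →
          ∑' k, μH (j + 1) k ^ 2 * ‖mFourierCoeff (fun x => (w (tStart (j + 1)) x : ℂ)) k‖ ^ 2 ≤
            (Real.sqrt (∑' k, μV j k ^ 2 * ‖mFourierCoeff (fun x => (w (tStart j + tHalf j) x : ℂ)) k‖ ^ 2) + εV j) ^ 2 +
              ζV j)
    (hbudget : Real.sqrt (q₀ ^ 2 + Z) + E < Real.sqrt (FluidPDE.Torus.scalarL2Sq θ₀)) :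
    ∃ χ : ℝ, 0 < χ ∧ ∃ A' : ℕ, ∃ κ₀ : ℝ, 0 < κ₀ ∧ ∀ κ ∈ Ioc (0 : ℝ) κ₀,
      ∀ w : ℝ → UnitAddTorus (Fin 2) → ℝ,
        FluidPDE.Torus.IsClassicalScalarTransportOn (Ico 0 1) κ P.field w → w 0 = θ₀ →
        ∃ K : ℝ, 0 ≤ K ∧ 1 ≤ 8 * Real.pi ^ 2 * κ * K ^ 2 * tHalf (Jrate r κ + A') ∧
          ENNReal.ofReal (2 * χ * FluidPDE.Torus.scalarL2Sq θ₀) ≤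
            highModeEnergy 0 K (w (tStart (Jrate r κ + A'))) +
              2 * FluidPDE.Torus.eScalarDissipation κ w 0 (tStart (Jrate r κ + A')) := by
  -- the fraction
  set L : ℝ := FluidPDE.Torus.scalarL2Sq θ₀ with hL
  set β : ℝ := Real.sqrt (q₀ ^ 2 + Z) + E with hβ
  have hE0 : 0 ≤ E := (Finset.sum_nonneg fun j _ => add_nonneg (hεH j) (hεV j)).trans (hE i₀)
  have hZ0 : 0 ≤ Z := (Finset.sum_nonneg fun j _ => add_nonneg (hζH j) (hζV j)).trans (hZ i₀)
  have hβ0 : 0 ≤ β := by positivity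
  have hβL : β ^ 2 < L := by
    have h := pow_lt_pow_left₀ hbudget hβ0 (by norm_num : (2 : ℕ) ≠ 0)
    rwa [Real.sq_sqrt hθ₀.le] at h
  set χ : ℝ := (1 - β ^ 2 / L) / 2 with hχ
  have hχ0 : 0 < χ := by
    rw [hχ]
    have : β ^ 2 / L < 1 := (div_lt_one hθ₀).2 hβL
    linarith
  have hχL : (1 - 2 * χ) * L = β ^ 2 := by
    rw [hχ]; field_simp; ring
  refine ⟨χ, hχ0, A, κ₁, hκ₁, fun κ hκ w hw h0 => ?_⟩
  have hκ0 : 0 < κ := hκ.1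
  set J : ℕ := Jrate r κ + A with hJ
  have hiJ : i₀ ≤ J := hiA.trans (Nat.le_add_left A _)
  refine ⟨c * ρ ^ J, by positivity, hlag κ hκ0, ?_⟩
  -- the tracked amplitudes
  set QH : ℕ → ℝ := fun j => Real.sqrt (∑' k, μH j k ^ 2 * ‖mFourierCoeff (fun x => (w (tStart j) x : ℂ)) k‖ ^ 2)
    with hQH
  set QV : ℕ → ℝ := fun j =>
    Real.sqrt (∑' k, μV j k ^ 2 * ‖mFourierCoeff (fun x => (w (tStart j + tHalf j) x : ℂ)) k‖ ^ 2) with hQV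
  have hQH0 : ∀ j, 0 ≤ QH j := fun j => Real.sqrt_nonneg _
  have hQV0 : ∀ j, 0 ≤ QV j := fun j => Real.sqrt_nonneg _
  have hQH2 : ∀ j, QH j ^ 2 = ∑' k, μH j k ^ 2 * ‖mFourierCoeff (fun x => (w (tStart j) x : ℂ)) k‖ ^ 2 := fun j =>
    Real.sq_sqrt (tsum_symbol_sq_nonneg _ _)
  have hQV2 : ∀ j, QV j ^ 2 = ∑' k, μV j k ^ 2 * ‖mFourierCoeff (fun x => (w (tStart j + tHalf j) x : ℂ)) k‖ ^ 2 :=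
    fun j => Real.sq_sqrt (tsum_symbol_sq_nonneg _ _)
  have hH : ∀ j, i₀ ≤ j → j < J → QV j ^ 2 ≤ (QH j + εH j) ^ 2 + ζH j := fun j hj hjJ => by
    rw [hQV2]; exact hstepH κ hκ w hw h0 j hj hjJ
  have hV : ∀ j, i₀ ≤ j → j < J → QH (j + 1) ^ 2 ≤ (QV j + εV j) ^ 2 + ζV j := fun j hj hjJ => by
    rw [hQH2]; exact hstepV κ hκ w hw h0 j hj hjJ
  have hchain := phase_chain_le_sharp hQH0 hQV0 hεH hεV hζH hζV i₀ J hiJ hH hV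
  have hq : QH i₀ ^ 2 ≤ q₀ ^ 2 := pow_le_pow_left₀ (hQH0 i₀) (hstart κ hκ w hw h0) 2
  have hQHJ : QH J ≤ β := by
    calc QH J ≤ Real.sqrt (QH i₀ ^ 2 + ∑ j ∈ Finset.Ico i₀ J, (ζH j + ζV j)) + ∑ j ∈ Finset.Ico i₀ J, (εH j + εV j) :=
          hchain
      _ ≤ Real.sqrt (q₀ ^ 2 + Z) + E := add_le_add (Real.sqrt_le_sqrt (add_le_add hq (hZ J))) (hE J)
  -- the low block at the final time
  set T : ℝ := tStart J with hT
  have hT0 : 0 ≤ T := tStart_nonneg J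
  have hT1 : T < 1 := tStart_lt_one J
  have hwT : Continuous (w T) := (hw.smooth_scalar.isSmooth_slice ⟨hT0, hT1⟩).continuous
  have hdom := lowModeEnergy_le_of_symbol hwT 0 (c * ρ ^ J) (hμH J) (hlow J hiJ)
  have hle : ∑' k, (if |(((k : Fin 2 → ℤ) 0 : ℤ) : ℝ)| < c * ρ ^ J then (1 : ℝ) else 0) *
        ‖mFourierCoeff (fun x => (w T x : ℂ)) k‖ ^ 2 ≤ (1 - 2 * χ) * FluidPDE.Torus.scalarL2Sq (w 0) := by
    rw [h0, ← hL, hχL]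
    refine hdom.trans ?_
    rw [← hQH2 J]
    exact pow_le_pow_left₀ (hQH0 J) hQHJ 2
  have hfin := stub_form_of_lowModeEnergy_le hκ0.le hw hT0 hT1 0 (c * ρ ^ J) hle
  rwa [h0] at hfin

/-! ## §3 Threshold form and the start socket -/

/-- **The tracked-symbol ledger gives the stub's conclusion — sharp budget, threshold form.**  As
`highModeConcentration_of_ledger_sharp`, but the lag requirements are asked only BELOW THE `κ`-THRESHOLD `κ₁`: for
`0 < κ ≤ κ₁`, `i₀ ≤ J_r(κ) + A` and `1 ≤ 8π²κ(cρ^{J_r(κ)+A})²·tHalf(J_r(κ)+A)` (so `A = 0` is allowed, cf.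
`…K1Ledger.exists_kappa_threshold`); `A ≥ i₀` is not required.  Same data and hypotheses otherwise as
`…K1Ledger.highModeConcentration_of_ledger` (symbol families `μᴴ, μⱽ`, `i₀ ≤ A`, low-block radius `cρ^J`, lag hypothesis,
non-negative `εᴴ, εⱽ, ζᴴ, ζⱽ` with partial sums `≤ E`, `≤ Z`, start bound `q₀` (any sign: only `q₀²` enters), per-half-slot energy-form inequalities for
`0 < κ ≤ κ₁` and every classical cascade scalar from `θ₀`), except that the budget is the SHARP one,
`√(q₀² + Z) + E < ‖θ₀‖_{L²}`: the start energy `q₀²` and the zone energies `Z` add under one root.  Conclusion: the body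
of `stub_highModeConcentration` for `(P, r, θ₀)` with `χ = (1 − (√(q₀²+Z)+E)²/‖θ₀‖²)/2`, lag `A`, `κ₀ = κ₁`, `K = cρ^J`.
[cite: DEIJ2022, (1.2)–(1.3)] [cite: Grafakos2014, Prop. 3.2.7 (3)] -/
theorem highModeConcentration_of_ledger_threshold (P : CascadeParams) (r : ℝ) {θ₀ : UnitAddTorus (Fin 2) → ℝ}
    (hθ₀ : 0 < FluidPDE.Torus.scalarL2Sq θ₀)
    (μH μV : ℕ → (Fin 2 → ℤ) → ℝ) {M : ℝ} (hμH : ∀ j k, |μH j k| ≤ M)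
    {i₀ A : ℕ} {c ρ : ℝ} (hc : 0 < c) (hρ : 0 ≤ ρ)
    (hlow : ∀ J, i₀ ≤ J → ∀ k : Fin 2 → ℤ, |((k 0 : ℤ) : ℝ)| < c * ρ ^ J → 1 ≤ μH J k ^ 2)
    {εH εV ζH ζV : ℕ → ℝ} (hεH : ∀ j, 0 ≤ εH j) (hεV : ∀ j, 0 ≤ εV j) (hζH : ∀ j, 0 ≤ ζH j) (hζV : ∀ j, 0 ≤ ζV j)
    {E Z : ℝ} (hE : ∀ n, ∑ j ∈ Finset.Ico i₀ n, (εH j + εV j) ≤ E) (hZ : ∀ n, ∑ j ∈ Finset.Ico i₀ n, (ζH j + ζV j) ≤ Z)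
    {q₀ κ₁ : ℝ} (hκ₁ : 0 < κ₁)
    (hthr : ∀ κ ∈ Ioc (0 : ℝ) κ₁, i₀ ≤ Jrate r κ + A ∧
      1 ≤ 8 * Real.pi ^ 2 * κ * (c * ρ ^ (Jrate r κ + A)) ^ 2 * tHalf (Jrate r κ + A))
    (hstart : ∀ κ ∈ Ioc (0 : ℝ) κ₁, ∀ w : ℝ → UnitAddTorus (Fin 2) → ℝ,
      FluidPDE.Torus.IsClassicalScalarTransportOn (Ico 0 1) κ P.field w → w 0 = θ₀ →
        Real.sqrt (∑' k, μH i₀ k ^ 2 * ‖mFourierCoeff (fun x => (w (tStart i₀) x : ℂ)) k‖ ^ 2) ≤ q₀)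
    (hstepH : ∀ κ ∈ Ioc (0 : ℝ) κ₁, ∀ w : ℝ → UnitAddTorus (Fin 2) → ℝ,
      FluidPDE.Torus.IsClassicalScalarTransportOn (Ico 0 1) κ P.field w → w 0 = θ₀ →
        ∀ j, i₀ ≤ j → j < Jrate r κ + A →
          ∑' k, μV j k ^ 2 * ‖mFourierCoeff (fun x => (w (tStart j + tHalf j) x : ℂ)) k‖ ^ 2 ≤
            (Real.sqrt (∑' k, μH j k ^ 2 * ‖mFourierCoeff (fun x => (w (tStart j) x : ℂ)) k‖ ^ 2) + εH j) ^ 2 + ζH j)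
    (hstepV : ∀ κ ∈ Ioc (0 : ℝ) κ₁, ∀ w : ℝ → UnitAddTorus (Fin 2) → ℝ,
      FluidPDE.Torus.IsClassicalScalarTransportOn (Ico 0 1) κ P.field w → w 0 = θ₀ →
        ∀ j, i₀ ≤ j → j < Jrate r κ + A →
          ∑' k, μH (j + 1) k ^ 2 * ‖mFourierCoeff (fun x => (w (tStart (j + 1)) x : ℂ)) k‖ ^ 2 ≤
            (Real.sqrt (∑' k, μV j k ^ 2 * ‖mFourierCoeff (fun x => (w (tStart j + tHalf j) x : ℂ)) k‖ ^ 2) + εV j) ^ 2 +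
              ζV j)
    (hbudget : Real.sqrt (q₀ ^ 2 + Z) + E < Real.sqrt (FluidPDE.Torus.scalarL2Sq θ₀)) :
    ∃ χ : ℝ, 0 < χ ∧ ∃ A' : ℕ, ∃ κ₀ : ℝ, 0 < κ₀ ∧ ∀ κ ∈ Ioc (0 : ℝ) κ₀,
      ∀ w : ℝ → UnitAddTorus (Fin 2) → ℝ,
        FluidPDE.Torus.IsClassicalScalarTransportOn (Ico 0 1) κ P.field w → w 0 = θ₀ →
        ∃ K : ℝ, 0 ≤ K ∧ 1 ≤ 8 * Real.pi ^ 2 * κ * K ^ 2 * tHalf (Jrate r κ + A') ∧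
          ENNReal.ofReal (2 * χ * FluidPDE.Torus.scalarL2Sq θ₀) ≤
            highModeEnergy 0 K (w (tStart (Jrate r κ + A'))) +
              2 * FluidPDE.Torus.eScalarDissipation κ w 0 (tStart (Jrate r κ + A')) := by
  -- the fraction
  set L : ℝ := FluidPDE.Torus.scalarL2Sq θ₀ with hL
  set β : ℝ := Real.sqrt (q₀ ^ 2 + Z) + E with hβ
  have hE0 : 0 ≤ E := (Finset.sum_nonneg fun j _ => add_nonneg (hεH j) (hεV j)).trans (hE i₀)
  have hZ0 : 0 ≤ Z := (Finset.sum_nonneg fun j _ => add_nonneg (hζH j) (hζV j)).trans (hZ i₀)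
  have hβ0 : 0 ≤ β := by positivity
  have hβL : β ^ 2 < L := by
    have h := pow_lt_pow_left₀ hbudget hβ0 (by norm_num : (2 : ℕ) ≠ 0)
    rwa [Real.sq_sqrt hθ₀.le] at h
  set χ : ℝ := (1 - β ^ 2 / L) / 2 with hχ
  have hχ0 : 0 < χ := by
    rw [hχ]
    have : β ^ 2 / L < 1 := (div_lt_one hθ₀).2 hβL
    linarith
  have hχL : (1 - 2 * χ) * L = β ^ 2 := by
    rw [hχ]; field_simp; ring
  refine ⟨χ, hχ0, A, κ₁, hκ₁, fun κ hκ w hw h0 => ?_⟩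
  have hκ0 : 0 < κ := hκ.1
  set J : ℕ := Jrate r κ + A with hJ
  have hiJ : i₀ ≤ J := (hthr κ hκ).1
  refine ⟨c * ρ ^ J, by positivity, (hthr κ hκ).2, ?_⟩
  -- the tracked amplitudes
  set QH : ℕ → ℝ := fun j => Real.sqrt (∑' k, μH j k ^ 2 * ‖mFourierCoeff (fun x => (w (tStart j) x : ℂ)) k‖ ^ 2)
    with hQH
  set QV : ℕ → ℝ := fun j =>
    Real.sqrt (∑' k, μV j k ^ 2 * ‖mFourierCoeff (fun x => (w (tStart j + tHalf j) x : ℂ)) k‖ ^ 2) with hQV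
  have hQH0 : ∀ j, 0 ≤ QH j := fun j => Real.sqrt_nonneg _
  have hQV0 : ∀ j, 0 ≤ QV j := fun j => Real.sqrt_nonneg _
  have hQH2 : ∀ j, QH j ^ 2 = ∑' k, μH j k ^ 2 * ‖mFourierCoeff (fun x => (w (tStart j) x : ℂ)) k‖ ^ 2 := fun j =>
    Real.sq_sqrt (tsum_symbol_sq_nonneg _ _)
  have hQV2 : ∀ j, QV j ^ 2 = ∑' k, μV j k ^ 2 * ‖mFourierCoeff (fun x => (w (tStart j + tHalf j) x : ℂ)) k‖ ^ 2 :=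
    fun j => Real.sq_sqrt (tsum_symbol_sq_nonneg _ _)
  have hH : ∀ j, i₀ ≤ j → j < J → QV j ^ 2 ≤ (QH j + εH j) ^ 2 + ζH j := fun j hj hjJ => by
    rw [hQV2]; exact hstepH κ hκ w hw h0 j hj hjJ
  have hV : ∀ j, i₀ ≤ j → j < J → QH (j + 1) ^ 2 ≤ (QV j + εV j) ^ 2 + ζV j := fun j hj hjJ => by
    rw [hQH2]; exact hstepV κ hκ w hw h0 j hj hjJ
  have hchain := phase_chain_le_sharp hQH0 hQV0 hεH hεV hζH hζV i₀ J hiJ hH hV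
  have hq : QH i₀ ^ 2 ≤ q₀ ^ 2 := pow_le_pow_left₀ (hQH0 i₀) (hstart κ hκ w hw h0) 2
  have hQHJ : QH J ≤ β := by
    calc QH J ≤ Real.sqrt (QH i₀ ^ 2 + ∑ j ∈ Finset.Ico i₀ J, (ζH j + ζV j)) + ∑ j ∈ Finset.Ico i₀ J, (εH j + εV j) :=
          hchain
      _ ≤ Real.sqrt (q₀ ^ 2 + Z) + E := add_le_add (Real.sqrt_le_sqrt (add_le_add hq (hZ J))) (hE J)
  -- the low block at the final time
  set T : ℝ := tStart J with hT
  have hT0 : 0 ≤ T := tStart_nonneg J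
  have hT1 : T < 1 := tStart_lt_one J
  have hwT : Continuous (w T) := (hw.smooth_scalar.isSmooth_slice ⟨hT0, hT1⟩).continuous
  have hdom := lowModeEnergy_le_of_symbol hwT 0 (c * ρ ^ J) (hμH J) (hlow J hiJ)
  have hle : ∑' k, (if |(((k : Fin 2 → ℤ) 0 : ℤ) : ℝ)| < c * ρ ^ J then (1 : ℝ) else 0) *
        ‖mFourierCoeff (fun x => (w T x : ℂ)) k‖ ^ 2 ≤ (1 - 2 * χ) * FluidPDE.Torus.scalarL2Sq (w 0) := by
    rw [h0, ← hL, hχL]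
    refine hdom.trans ?_
    rw [← hQH2 J]
    exact pow_le_pow_left₀ (hQH0 J) hQHJ 2
  have hfin := stub_form_of_lowModeEnergy_le hκ0.le hw hT0 hT1 0 (c * ρ ^ J) hle
  rwa [h0] at hfin


/-- **The start socket.**  If a real symbol `μ` satisfies `|μ| ≤ 1` everywhere and VANISHES on a set `G` of modes, then the
tracked energy of any continuous real `θ` is at most its energy off `G`:
`Σ μ²|𝓕θ|² ≤ Σ_{k∉G} |𝓕θ(k)|²` — the form in which the first good piece (S-D: the energy of `w(tStart i₀)` outside the
start-of-phase good region is `≤ q₀²`) feeds `hstart` for any symbol family whose start symbol is `≥`-compatible with that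
region. [cite: Grafakos2014, Prop. 3.2.7 (3)] -/
theorem tsum_symbol_sq_le_energy_off {d : Type*} [Fintype d] {θ : UnitAddTorus d → ℝ} (hθ : Continuous θ)
    {μ : (d → ℤ) → ℝ} (hμ1 : ∀ k, |μ k| ≤ 1) (G : Set (d → ℤ)) [DecidablePred (· ∈ G)]
    (hμG : ∀ k ∈ G, μ k = 0) :
    ∑' k, μ k ^ 2 * ‖mFourierCoeff (fun x => (θ x : ℂ)) k‖ ^ 2 ≤
      ∑' k, (if k ∈ G then (0 : ℝ) else 1) * ‖mFourierCoeff (fun x => (θ x : ℂ)) k‖ ^ 2 := by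
  have hP := hasSum_sq_norm_mFourierCoeff_scalarL2Sq hθ
  have hle : ∀ k, μ k ^ 2 * ‖mFourierCoeff (fun x => (θ x : ℂ)) k‖ ^ 2 ≤
      (if k ∈ G then (0 : ℝ) else 1) * ‖mFourierCoeff (fun x => (θ x : ℂ)) k‖ ^ 2 := fun k => by
    refine mul_le_mul_of_nonneg_right ?_ (sq_nonneg _)
    split_ifs with h
    · rw [hμG k h]; norm_num
    · have := hμ1 k
      rw [← sq_abs]; nlinarith [abs_nonneg (μ k)]
  have hs1 : Summable fun k => (if k ∈ G then (0 : ℝ) else 1) * ‖mFourierCoeff (fun x => (θ x : ℂ)) k‖ ^ 2 :=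
    (hP.summable.mul_left 1).of_nonneg_of_le (fun k => by positivity) fun k => by
      refine mul_le_mul_of_nonneg_right ?_ (sq_nonneg _)
      split_ifs <;> norm_num
  exact (hs1.of_nonneg_of_le (fun k => by positivity) hle).tsum_le_tsum hle hs1

end Summit.AnomalousDissipation.AnomalousDissipation.Theorems.SawtoothPulseCascade.K1Ledger
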